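import Mathlib
import HarnessLib
import Summits.SmoothPoincare4.Statement
import Literature.Geometry.Symplectic.SteinDomain
import Literature.Geometry.Symplectic.SteinBoundaryContact
import Literature.AlgebraicTopology.SingularHomology.SingularChains

/-!
# SmoothPoincare4 / ConvexBisection — assembly, structural form

Settles item stmt-SmoothPoincare4-14054 (assembly of route ConvexBisection, rev 3, structural form):

  (body of `AcyclicBisectionExists`) → (body of `AcyclicBisectionRigidity`) → `SmoothPoincare4`,

i.e. (every Hausdorff second-countable `C^∞` 4-manifold `M` with `M ≃ₕ S⁴` admits a Stein bisection
along a common contact seam whose two halves are rationally acyclic) → (every such `M` carrying such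
a bisection is diffeomorphic to `S⁴`) → the smooth 4-dimensional Poincaré conjecture.

The statement below is, token for token, the body of the route declaration
`Summit.SmoothPoincare4.SmoothPoincare4.Theses.ConvexBisection.Assembly`, so that the route file can
link it as `theorem Assembly_holds : Assembly := _root_.<this theorem>` (definitional unfolding).

Design choice (planner's repair note of 2026-08-16): this module deliberately does NOT import the
route file `Summits.SmoothPoincare4.SmoothPoincare4.Theses.ConvexBisection` — the gate auto-imports
the closing module into that Theses file, and a Theses import here would close an import cycle
(which is what retired the by-name proof `Theorems/ConvexBisectionAssembly.lean` of the previous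
form stmt-SmoothPoincare4-3549).  Imports are exactly the problem statement plus the Literature
modules providing `SteinStructure`, `contactPlane` and `singularHomology`.

Proof: pure logic — unfold `SmoothPoincare4`, fix `M` and the homotopy equivalence `e : M ≃ₕ S⁴`,
take the acyclic Stein bisection of `M` from the first hypothesis and feed it to the second
(the same three lines as the route's deciding theorem `ConvexBisection.closes`).  No named facts.
-/

open scoped Manifold ContDiff
open ContinuousMap

-- the prescribed namespace `Summit.<P>.<Sub>.Theorems` duplicates `SmoothPoincare4` (P = Sub, D-0017)
set_option linter.dupNamespace false

namespace Summit.SmoothPoincare4.SmoothPoincare4.Theorems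

/-- Settles stmt-SmoothPoincare4-14054 (assembly of route ConvexBisection, structural form):
if every Hausdorff second-countable smooth 4-manifold `M` homotopy equivalent to `S⁴` admits a
Stein bisection `M = e₁(W₁) ∪ e₂(W₂)` along a common contact seam (two compact Stein domains
smoothly embedded, covering `M`, meeting exactly in the images of their boundaries, with equal
pushed-forward complex tangencies on the seam) whose halves are rationally acyclic
(`H_k(Wᵢ; ℚ) = 0` for `k > 0`), and if every such `M` with such a bisection is diffeomorphic to
`S⁴`, then `SmoothPoincare4` holds.  Verbatim the body of
`Summit.SmoothPoincare4.SmoothPoincare4.Theses.ConvexBisection.Assembly`; proof by composing the two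
hypotheses pointwise in `M`. [folklore] -/
theorem convexBisection_assembly_structural :
    (∀ (M : Type) [TopologicalSpace M] [T2Space M] [SecondCountableTopology M] [ChartedSpace (EuclideanSpace ℝ (Fin 4)) M] [IsManifold (𝓡 4) ∞ M], M ≃ₕ Metric.sphere (0 : EuclideanSpace ℝ (Fin 5)) 1 → ∃ (W₁ : Type) (_ : TopologicalSpace W₁) (_ : ChartedSpace (EuclideanHalfSpace 4) W₁) (_ : IsManifold (𝓡∂ 4) ∞ W₁) (_ : CompactSpace W₁) (W₂ : Type) (_ : TopologicalSpace W₂) (_ : ChartedSpace (EuclideanHalfSpace 4) W₂) (_ : IsManifold (𝓡∂ 4) ∞ W₂) (_ : CompactSpace W₂) (J₁ : Literature.Geometry.Symplectic.SteinStructure W₁) (J₂ : Literature.Geometry.Symplectic.SteinStructure W₂) (e₁ : W₁ → M) (e₂ : W₂ → M), Manifold.IsSmoothEmbedding (𝓡∂ 4) (𝓡 4) ∞ e₁ ∧ Manifold.IsSmoothEmbedding (𝓡∂ 4) (𝓡 4) ∞ e₂ ∧ Set.range e₁ ∪ Set.range e₂ = Set.univ ∧ Set.range e₁ ∩ Set.range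 e₂ = e₁ '' (𝓡∂ 4).boundary W₁ ∧ Set.range e₁ ∩ Set.range e₂ = e₂ '' (𝓡∂ 4).boundary W₂ ∧ (∀ w₁ w₂, e₁ w₁ = e₂ w₂ → Submodule.map (mfderiv (𝓡∂ 4) (𝓡 4) e₁ w₁).toLinearMap (Literature.Geometry.Symplectic.contactPlane J₁.J w₁) = Submodule.map (mfderiv (𝓡∂ 4) (𝓡 4) e₂ w₂).toLinearMap (Literature.Geometry.Symplectic.contactPlane J₂.J w₂)) ∧ (∀ k, 0 < k → CategoryTheory.Limits.IsZero (Literature.AlgebraicTopology.SingularHomology.singularHomology ℚ ℚ W₁ k) ∧ CategoryTheory.Limits.IsZero (Literature.AlgebraicTopology.SingularHomology.singularHomology ℚ ℚ W₂ k))) → (∀ (M : Type) [TopologicalSpace M] [T2Space M] [SecondCountableTopology M] [ChartedSpace (EuclideanSpace ℝ (Fin 4)) M] [IsManifold (𝓡 4) ∞ M], M ≃ₕ Metric.sphere (0 : EuclideanSpace ℝ (Fin 5)) 1 → (∃ (W₁ : Type) (_ : TopologicalSpace W₁) (_ : ChartedSpace (EuclideanHalfSpace 4) W₁) (_ : IsManifold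 (𝓡∂ 4) ∞ W₁) (_ : CompactSpace W₁) (W₂ : Type) (_ : TopologicalSpace W₂) (_ : ChartedSpace (EuclideanHalfSpace 4) W₂) (_ : IsManifold (𝓡∂ 4) ∞ W₂) (_ : CompactSpace W₂) (J₁ : Literature.Geometry.Symplectic.SteinStructure W₁) (J₂ : Literature.Geometry.Symplectic.SteinStructure W₂) (e₁ : W₁ → M) (e₂ : W₂ → M), Manifold.IsSmoothEmbedding (𝓡∂ 4) (𝓡 4) ∞ e₁ ∧ Manifold.IsSmoothEmbedding (𝓡∂ 4) (𝓡 4) ∞ e₂ ∧ Set.range e₁ ∪ Set.range e₂ = Set.univ ∧ Set.range e₁ ∩ Set.range e₂ = e₁ '' (𝓡∂ 4).boundary W₁ ∧ Set.range e₁ ∩ Set.range e₂ = e₂ '' (𝓡∂ 4).boundary W₂ ∧ (∀ w₁ w₂, e₁ w₁ = e₂ w₂ → Submodule.map (mfderiv (𝓡∂ 4) (𝓡 4) e₁ w₁).toLinearMap (Literature.Geometry.Symplectic.contactPlane J₁.J w₁) = Submodule.map (mfderiv (𝓡∂ 4) (𝓡 4) e₂ w₂).toLinearMap (Literature.Geometry.Symplectic.contactPlane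 J₂.J w₂)) ∧ (∀ k, 0 < k → CategoryTheory.Limits.IsZero (Literature.AlgebraicTopology.SingularHomology.singularHomology ℚ ℚ W₁ k) ∧ CategoryTheory.Limits.IsZero (Literature.AlgebraicTopology.SingularHomology.singularHomology ℚ ℚ W₂ k))) → Nonempty (M ≃ₘ⟮𝓡 4, 𝓡 4⟯ Metric.sphere (0 : EuclideanSpace ℝ (Fin 5)) 1)) → SmoothPoincare4 := by
  intro hE hR M _ _ _ _ _ e
  exact hR M e (hE M e)

end Summit.SmoothPoincare4.SmoothPoincare4.Theorems
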